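import Mathlib
import Summits.NavierStokesRegularity.NavierStokesRegularity.Theorems.TypeIQuarterGateScarEnvelopeTypeIZoomDictionaryDefs

/-!
# Gallery vocabulary for the 23843 zoom dictionary: gallery limits and root ω-limits

The GALLERY (Furstenberg) of a field `U` on the closed past: all `L³_loc` limits, on every backward
cylinder `Q_R(0)`, of the Navier–Stokes zooms `zoom U x 0 l` with FREE final-time centres `x` and
positive scales `l`; and the ROOT ω-LIMITS (centres frozen at the origin, scales `→ 0`).

These are the objects of the crux idea `Cruxes/ScarEnvelopeTypeI/Ideas/zoom-recurrence.md`
(ns-idea-17 g0, lens «control») for the crux `TypeIQuarterGate.ScarEnvelopeTypeI` (item 23843),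
typed in the TREE's convention: unlike the card's `GalleryLimit` / `RootOmegaLimit`, the limit field
is required to lie in `L³(Q_R(0))` for every `R > 0` (exactly as the dictionary's `TangentU` requires
`MemLp (uncurry ū) 3`), since Mathlib's `eLpNorm` is a lower integral and a non-measurable «limit»
would make both the transitivity of the gallery and the a.e.-identification with A–B
representatives fail.  Scales are only required positive (the A–B class and `𝐈` over the open past
are scale-invariant); the card's mini-set convention `l ≤ 1` is the special case recorded by
`IsGalleryLimit.of_le_one`-type users, not needed by the compactness / transitivity theorems.

Definitions only; the theorems are in `…SatelliteTowerGalleryCompactness` (compactness + closure of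
the A–B class under gallery limits, one factor 4) and `…SatelliteTowerGalleryTransitive`
(transitivity; root ω-limits).  HONEST FRAMING: vocabulary about hypothetical Type-I zoom limits;
nothing open is proved — 23843, `∀ M, ¬ OneScarLeaf M`, `∀ M, ¬ InfiniteDescent M`, the route and
Navier–Stokes regularity are OPEN.  LEAD-lineage prover ns-sz-p1 g6; statements after ns-idea-17's
card; `--supports stmt-NavierStokesRegularity-23843 --as helper`.
-/

noncomputable section

-- the summit-side namespace repeats a component by design (single-conjunct summit, D-0017)
set_option linter.dupNamespace false

open MeasureTheory Set Metric Filter Topology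
open scoped ENNReal

namespace Summit.NavierStokesRegularity.NavierStokesRegularity.Cruxes.ScarEnvelopeTypeI.ZoomDictionary

open Literature.Analysis.FluidPDE

/-- `W` lies in `L³` of every backward cylinder `Q_R(0)`, `R > 0` (the closed-past `L³_loc` class in
which tangent flows and gallery limits are taken). -/
def L3loc (W : ℝ → (EuclideanSpace ℝ (Fin 3)) → (EuclideanSpace ℝ (Fin 3))) : Prop :=
  ∀ R : ℝ, 0 < R → MemLp (Function.uncurry W) 3
    (volume.restrict (parabolicCylinder R (0 : ℝ × (EuclideanSpace ℝ (Fin 3)))))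

/-- The zooms `zoom U (x j) 0 (l j)` converge to `W` in `L³(Q_R(0))` for EVERY `R > 0`. -/
def ZoomsTendsto (U : ℝ → (EuclideanSpace ℝ (Fin 3)) → (EuclideanSpace ℝ (Fin 3)))
    (x : ℕ → (EuclideanSpace ℝ (Fin 3))) (l : ℕ → ℝ)
    (W : ℝ → (EuclideanSpace ℝ (Fin 3)) → (EuclideanSpace ℝ (Fin 3))) : Prop :=
  ∀ R : ℝ, 0 < R → Tendsto (fun j => eLpNorm
    (Function.uncurry (zoom U (x j) 0 (l j)) - Function.uncurry W) 3
    (volume.restrict (parabolicCylinder R (0 : ℝ × (EuclideanSpace ℝ (Fin 3)))))) atTop (𝓝 0)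

/-- `W` is a **GALLERY LIMIT** (micro-flow) of `U`: `W ∈ L³_loc` of the closed past and it is the
`L³(Q_R(0))`-limit, for every `R > 0`, of zooms of `U` with free final-time centres `x j` and
positive scales `l j` (ns-idea-17's `GalleryLimit` with the `L³_loc` clause of the tree's `TangentU`
added and the scale constraint `l ≤ 1` dropped). -/
def IsGalleryLimit (U W : ℝ → (EuclideanSpace ℝ (Fin 3)) → (EuclideanSpace ℝ (Fin 3))) : Prop :=
  L3loc W ∧ ∃ (x : ℕ → (EuclideanSpace ℝ (Fin 3))) (l : ℕ → ℝ), (∀ j, 0 < l j) ∧ ZoomsTendsto U x l W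

/-- `W` is a **ROOT ω-LIMIT** of `U`: a gallery limit with all centres at the root `(0,0)` and
scales `l j → 0` (an `L³_loc` tangent flow of `U` at the origin along some null sequence). -/
def IsRootOmegaLimit (U W : ℝ → (EuclideanSpace ℝ (Fin 3)) → (EuclideanSpace ℝ (Fin 3))) : Prop :=
  L3loc W ∧ ∃ l : ℕ → ℝ, (∀ j, 0 < l j) ∧ Tendsto l atTop (𝓝 0) ∧ ZoomsTendsto U (fun _ => 0) l W

end Summit.NavierStokesRegularity.NavierStokesRegularity.Cruxes.ScarEnvelopeTypeI.ZoomDictionary
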